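import Summits.BirchSwinnertonDyer.BirchSwinnertonDyer.Theorems.UniversalToricDescentSquaresCommutantPlane
import Literature.NumberTheory.EllipticCurves.ModPSchurOrdinaryBaseChangeProofs
import Literature.NumberTheory.EllipticCurves.MazurTorsionGaloisStructureProofs
import Literature.NumberTheory.GaloisRepresentations.AbsGaloisOuterConj
import Literature.NumberTheory.EllipticCurves.HeegnerPoints
import Literature.NumberTheory.EllipticCurves.TorsionStructureProofs
import Summits.BirchSwinnertonDyer.BirchSwinnertonDyer.Theorems.PrintCFramBottomClassIndexLawFiveLeEisensteinLineCharacter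
import HarnessLib

/-!
# Schur's lemma and irreducibility for `E[p]` over a quadratic field from SURJECTIVITY of `ρ̄_{E,p}` over `ℚ`
# (`p` odd) — the `hschur` / `hirr` inputs of the twin's Eisenstein `DVRSetting` at `p = 3`

Helper file (THEOREMS ONLY: no definition, no named fact, no instance, no `sorry`) for crux r205
stmt-BirchSwinnertonDyer-24737 `…Theses.UniversalToricDescent.TwinAlgMuZeroAtThree`, line `beta-road` (skeleton v10
cd44fe9d5c6b9a78), stub `stub_howardOutputsOfFamily` (K2_Howard ∣ β): the E2 unit («H-twin») of that stub feeds cell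
x9's `WeierstrassCurve.eisensteinDVRSettingTame_satisfiesH_of`, whose hypotheses `hirr` / `hschur` ask that `E′[3]` be
irreducible over `K` and that every `Γ_K`-equivariant additive endomorphism of `E′_K(K̄)[3]` be an integer scalar
(Howard 2004, §1.3, hypothesis H.1: the residual representation is ABSOLUTELY irreducible over `K`).  The tree's
`Literature.NumberTheory.EllipticCurves.exists_forall_eq_zsmul_baseChange_of_ordinary` proves this at a good ORDINARY
`p ∤ 2 d_K` from `(irr_K)` (inertia device); the twin `E′` of the crux is MULTIPLICATIVE at `3`, so that theorem does
not apply.  Here both statements are derived, for ANY quadratic number field `K` and ANY odd prime `p`, from the crux's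
own hypothesis `W′.HasSurjectiveModNGaloisRep 3` (`ρ̄_{E′,3} : Γ_ℚ ↠ Aut E′[3] ≅ GL₂(𝔽₃)`) by the SQUARES TRICK:

* `K/ℚ` quadratic is Galois, so `res(Γ_K) ⊴ Γ_ℚ` has index `2` and contains `σ²` for every `σ ∈ Γ_ℚ` (tree
  `PrintCFram.LineCharacter.sq_mem_range_absGaloisRestrict_of_finrank_eq_two`; frames `E[p] ≃ (ℤ/p)²` are the tree's
  `WeierstrassCurve.nonempty_geomTorsion_addEquiv_fin_two`);
* hence `ρ̄(Γ_K)` contains the square `u ∘ u` of EVERY additive automorphism `u` of `E[p] ≅ 𝔽_p²`; the algebra of the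
  squared transvections is `…Theorems.UniversalToricDescentSquaresCommutantPlane` (commutant `= 𝔽_p`, stable subgroups
  `⊥`/`⊤`, `p` odd);
* `exists_forall_eq_zsmul_of_hasSurjectiveModNGaloisRep` / `eq_bot_or_eq_top_of_hasSurjectiveModNGaloisRep` (`Γ_F`-currency,
  any field `F ∌ p = 0`, any set `S ⊆ Γ_F` containing all squares), `exists_forall_eq_zsmul_baseChange_of_hasSurjectiveModNGaloisRep`
  and `hasIrreducibleModPGaloisRep_baseChange_of_hasSurjectiveModNGaloisRep` (`K` quadratic, along the tree's equivariant
  `E(ℚ̄)[p] ≃ E_K(K̄)[p]`, `exists_addEquiv_geomTorsion_baseChange`);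
* `exists_sq_smul_eq_neg_of_hasSurjectiveModNGaloisRep`, `exists_smul_eq_neg_baseChange_of_hasSurjectiveModNGaloisRep` —
  `−1 = (0 −1; 1 0)²` is a square, so some `z ∈ Γ_K` acts as the homothety `−1` on `E_K[p]` (input `hz`/`ha` of x9's
  `eisensteinTower_h2Tower`, Howard's H.2 by Sah's lemma);
* `twin_hschur_at_three` / `twin_hirr_at_three` / `twin_homothety_at_three` — the inputs VERBATIM in the binder shape of
  `eisensteinDVRSettingTame_satisfiesH_of` for `W′.baseChange K`, `p = 3`, `K` imaginary quadratic
  (`IsImaginaryQuadratic K`), from `W′.HasSurjectiveModNGaloisRep 3` alone (no `(N′, d_K) = 1`, no reduction type).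

«beyond-print theorem»: no (textbook).  BSD is NOT proved by this file; 24737 stays OPEN.

References: J.-P. Serre, Invent. Math. 15 (1972), §2 [Serre1972]; B. Howard, Compositio Math. 140 (2004), §1.3 H.1
[Howard2004HeegnerKolyvagin]; S. Lang, *Algebra*, Ch. XVII §1 (Schur) [Lang2002]; J. H. Silverman, AEC III.§7
[SilvermanAEC2009].
-/

set_option autoImplicit false
set_option linter.dupNamespace false

noncomputable section

open scoped Classical NumberField

namespace Summit.BirchSwinnertonDyer.BirchSwinnertonDyer.Theorems.UniversalToricDescentTwinSchurAtThree

open WeierstrassCurve Field Literature Literature.NumberTheory.EllipticCurves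
  Literature.NumberTheory.GaloisRepresentations
  Summit.BirchSwinnertonDyer.BirchSwinnertonDyer.Theorems.UniversalToricDescentSquaresCommutantPlane
open Summit.BirchSwinnertonDyer.BirchSwinnertonDyer.Theorems.PrintCFram.LineCharacter
  (sq_mem_range_absGaloisRestrict_of_finrank_eq_two)

universe u

/-! ### §0 One more automorphism of the plane: the rotation `(0 −1; 1 0)`, whose square is `−1` -/

section Rotation

variable {p : ℕ} {V : Type*} [AddCommGroup V]

/-- The rotation `(x₀, x₁) ↦ (−x₁, x₀)` of `(ℤ/p)²` (matrix `(0 −1; 1 0)`, an element of `SL₂(𝔽_p)` of order `4`): an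
additive automorphism `R` with `R (R y) = −y`. [folklore] -/
theorem exists_addEquiv_sq_eq_neg_plane :
    ∃ R : (Fin 2 → ZMod p) ≃+ (Fin 2 → ZMod p), ∀ y, R (R y) = -y := by
  refine ⟨{ toFun := fun x i ↦ if i = 0 then -(x 1) else x 0,
            invFun := fun y i ↦ if i = 0 then y 1 else -(y 0),
            left_inv := fun x ↦ ?_,
            right_inv := fun y ↦ ?_,
            map_add' := fun x y ↦ ?_ }, fun y ↦ ?_⟩
  · funext i
    fin_cases i
    · simp only [Fin.zero_eta, Fin.isValue, if_true, one_ne_zero, if_false]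
    · simp only [Fin.mk_one, Fin.isValue, one_ne_zero, if_false, if_true, neg_neg]
  · funext i
    fin_cases i
    · simp only [Fin.zero_eta, Fin.isValue, if_true, one_ne_zero, if_false, neg_neg]
    · simp only [Fin.mk_one, Fin.isValue, one_ne_zero, if_false, if_true]
  · funext i
    fin_cases i
    · simp only [Fin.zero_eta, Fin.isValue, if_true, Pi.add_apply, neg_add]
    · simp only [Fin.mk_one, Fin.isValue, one_ne_zero, if_false, Pi.add_apply]
  · funext i
    fin_cases i
    · simp only [AddEquiv.coe_mk, Equiv.coe_fn_mk, Fin.zero_eta, Fin.isValue, if_true, one_ne_zero, if_false,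
        Pi.neg_apply]
    · simp only [AddEquiv.coe_mk, Equiv.coe_fn_mk, Fin.mk_one, Fin.isValue, one_ne_zero, if_false, if_true,
        Pi.neg_apply]

/-- A framed plane `V ≃ (ℤ/p)²` has an additive automorphism `u` with `u ∘ u = −1`. [folklore] -/
theorem exists_addEquiv_sq_eq_neg (e : V ≃+ (Fin 2 → ZMod p)) : ∃ u : V ≃+ V, ∀ x, u (u x) = -x := by
  obtain ⟨R, hR⟩ := exists_addEquiv_sq_eq_neg_plane (p := p)
  refine ⟨e.trans (R.trans e.symm), fun x ↦ ?_⟩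
  simp only [AddEquiv.trans_apply, AddEquiv.apply_symm_apply, hR, map_neg, AddEquiv.symm_apply_apply]

end Rotation

/-! ### §1 `E[p]` with surjective `ρ̄_{E,p}`: Schur and irreducibility for any set of Galois elements containing all squares -/

section Galois

variable {F : Type u} [Field F] (W : WeierstrassCurve F) [W.IsElliptic] (p : ℕ) [hp : Fact p.Prime]
  [NeZero (p : F)]

variable {W p} in
omit [W.IsElliptic] hp [NeZero (p : F)] in
/-- `ρ̄(σ) = u` read on points: `σ • Q = u Q`. [folklore] -/
theorem smul_eq_of_galoisRepTorsion_eq {σ : absoluteGaloisGroup F} {u : geomTorsion W (p : ℤ) ≃+ geomTorsion W (p : ℤ)}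
    (hσ : galoisRepTorsion W (p : ℤ) σ = Multiplicative.ofAdd u) (Q : geomTorsion W (p : ℤ)) :
    σ • Q = u Q := by
  rw [← galoisRepTorsion_apply W p σ Q, hσ]
  rfl

/-- **Schur for `E[p]` from surjectivity of `ρ̄_{E,p}` (`p` odd), `Γ_F`-currency.** Let `S ⊆ Γ_F` contain `σ²` for
every `σ ∈ Γ_F` and let `ρ̄_{E,p} : Γ_F → Aut E[p]` be onto.  Then every additive endomorphism of `E[p]` commuting with
`S` is multiplication by an integer (`S` acts through all squares of `Aut E[p] ≅ GL₂(𝔽_p)`, file `…SquaresCommutantPlane`).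
[cite: Serre1972, §2 (subgroups of GL₂(𝔽_p))] [cite: Lang2002, Ch. XVII §1 Prop. 1.1 (Schur's lemma)] -/
theorem exists_forall_eq_zsmul_of_hasSurjectiveModNGaloisRep (hp2 : p ≠ 2)
    (hsurj : W.HasSurjectiveModNGaloisRep (p : ℤ)) (S : Set (absoluteGaloisGroup F))
    (hS : ∀ σ : absoluteGaloisGroup F, σ * σ ∈ S)
    (φ : geomTorsion W (p : ℤ) →+ geomTorsion W (p : ℤ))
    (hφ : ∀ σ ∈ S, ∀ P : geomTorsion W (p : ℤ), φ (σ • P) = σ • φ P) :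
    ∃ c : ℤ, ∀ P : geomTorsion W (p : ℤ), φ P = c • P := by
  obtain ⟨e⟩ := nonempty_geomTorsion_addEquiv_fin_two W (m := p) (NeZero.ne _)
  refine exists_forall_eq_zsmul_of_forall_sq_comm hp2 e φ fun u P ↦ ?_
  obtain ⟨σ, hσ⟩ := hsurj (Multiplicative.ofAdd u)
  have h := hφ (σ * σ) (hS σ) P
  rw [mul_smul, mul_smul, smul_eq_of_galoisRepTorsion_eq hσ, smul_eq_of_galoisRepTorsion_eq hσ,
    smul_eq_of_galoisRepTorsion_eq hσ, smul_eq_of_galoisRepTorsion_eq hσ] at h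
  exact h

/-- **Irreducibility of `E[p]` for any `S ⊆ Γ_F` containing all squares, from surjectivity of `ρ̄_{E,p}` (`p` odd).**
Every `S`-stable subgroup of `E[p]` is `⊥` or `⊤`. [cite: Serre1972, §2 (subgroups of GL₂(𝔽_p))] -/
theorem eq_bot_or_eq_top_of_hasSurjectiveModNGaloisRep (hp2 : p ≠ 2)
    (hsurj : W.HasSurjectiveModNGaloisRep (p : ℤ)) (S : Set (absoluteGaloisGroup F))
    (hS : ∀ σ : absoluteGaloisGroup F, σ * σ ∈ S)
    (Φ : AddSubgroup (geomTorsion W (p : ℤ))) (hΦ : ∀ σ ∈ S, ∀ P ∈ Φ, σ • P ∈ Φ) :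
    Φ = ⊥ ∨ Φ = ⊤ := by
  obtain ⟨e⟩ := nonempty_geomTorsion_addEquiv_fin_two W (m := p) (NeZero.ne _)
  refine eq_bot_or_eq_top_of_forall_sq_stable hp2 e Φ fun u P hP ↦ ?_
  obtain ⟨σ, hσ⟩ := hsurj (Multiplicative.ofAdd u)
  have h := hΦ (σ * σ) (hS σ) P hP
  rw [mul_smul, smul_eq_of_galoisRepTorsion_eq hσ, smul_eq_of_galoisRepTorsion_eq hσ] at h
  exact h

omit hp in
/-- **A square of `Γ_F` acting as `−1` on `E[p]`**, from surjectivity of `ρ̄_{E,p}`: `−1 = R²` for the rotation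
`R = (0 −1; 1 0) ∈ Aut E[p]`, and `R = ρ̄(σ)`. [cite: Serre1972, §2 (subgroups of GL₂(𝔽_p))] -/
theorem exists_sq_smul_eq_neg_of_hasSurjectiveModNGaloisRep (hsurj : W.HasSurjectiveModNGaloisRep (p : ℤ)) :
    ∃ σ : absoluteGaloisGroup F, ∀ P : geomTorsion W (p : ℤ), (σ * σ) • P = -P := by
  obtain ⟨e⟩ := nonempty_geomTorsion_addEquiv_fin_two W (m := p) (NeZero.ne _)
  obtain ⟨u, hu⟩ := exists_addEquiv_sq_eq_neg e
  obtain ⟨σ, hσ⟩ := hsurj (Multiplicative.ofAdd u)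
  refine ⟨σ, fun P ↦ ?_⟩
  rw [mul_smul, smul_eq_of_galoisRepTorsion_eq hσ, smul_eq_of_galoisRepTorsion_eq hσ, hu]

end Galois

/-! ### §2 Over a quadratic field `K` (`res(Γ_K)` contains all squares of `Γ_ℚ`) -/

section Quadratic

variable (W : WeierstrassCurve ℚ) [W.IsElliptic] (K : Type) [Field K] [NumberField K]

/-- **Schur for `E[p]` over a quadratic field `K` from surjectivity of `ρ̄_{E,p}` over `ℚ` (`p` odd).** For `E/ℚ`
with `ρ̄_{E,p} : Γ_ℚ ↠ Aut E[p]` and `[K : ℚ] = 2`, every `Γ_K`-equivariant additive endomorphism of `E_K(K̄)[p]` is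
multiplication by an integer: `End_{𝔽_p[Γ_K]}(E[p]) = 𝔽_p`, i.e. `E[p]` is ABSOLUTELY irreducible over `K` (Howard
2004 §1.3, hypothesis H.1).  No hypothesis on the reduction of `E` at `p` nor on `d_K`.  (Transport along the tree's
equivariant `E(ℚ̄)[p] ≃ E_K(K̄)[p]`, then §1 with `S = res(Γ_K) ∋` all squares.)
[cite: Howard2004HeegnerKolyvagin, §1.3 hypothesis H.1] [cite: Serre1972, §2 (subgroups of GL₂(𝔽_p))] -/
theorem exists_forall_eq_zsmul_baseChange_of_hasSurjectiveModNGaloisRep (h2 : Module.finrank ℚ K = 2)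
    {p : ℕ} [Fact p.Prime] (hp2 : p ≠ 2) (hsurj : W.HasSurjectiveModNGaloisRep (p : ℤ))
    (φ : geomTorsion (W.baseChange K) (p : ℤ) →+ geomTorsion (W.baseChange K) (p : ℤ))
    (hφ : ∀ (γ : absoluteGaloisGroup K) (P : geomTorsion (W.baseChange K) (p : ℤ)),
      φ (γ • P) = γ • φ P) :
    ∃ c : ℤ, ∀ P : geomTorsion (W.baseChange K) (p : ℤ), φ P = c • P := by
  haveI : NeZero ((p : ℕ) : ℚ) := ⟨by exact_mod_cast (Fact.out : p.Prime).ne_zero⟩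
  obtain ⟨ψ, hψ⟩ := exists_addEquiv_geomTorsion_baseChange W K (p : ℤ)
  set χ : geomTorsion W (p : ℤ) →+ geomTorsion W (p : ℤ) :=
    (ψ.symm.toAddMonoidHom.comp φ).comp ψ.toAddMonoidHom with hχdef
  have hχapply : ∀ T, χ T = ψ.symm (φ (ψ T)) := fun T ↦ rfl
  have hχ : ∀ σ ∈ ((absGaloisRestrict ℚ K).range : Set (absoluteGaloisGroup ℚ)),
      ∀ T : geomTorsion W (p : ℤ), χ (σ • T) = σ • χ T := by
    rintro σ ⟨γ, rfl⟩ T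
    rw [hχapply, hχapply]
    apply ψ.injective
    change ψ (ψ.symm (φ (ψ (absGaloisRestrict ℚ K γ • T)))) =
      ψ (absGaloisRestrict ℚ K γ • ψ.symm (φ (ψ T)))
    rw [AddEquiv.apply_symm_apply, hψ, hφ, hψ, AddEquiv.apply_symm_apply]
  obtain ⟨c, hc⟩ := exists_forall_eq_zsmul_of_hasSurjectiveModNGaloisRep W p hp2 hsurj _
    (fun σ ↦ sq_mem_range_absGaloisRestrict_of_finrank_eq_two K h2 σ) χ hχ
  refine ⟨c, fun P ↦ ?_⟩
  have h := congrArg ψ (hc (ψ.symm P))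
  rw [hχapply, AddEquiv.apply_symm_apply, AddEquiv.apply_symm_apply, map_zsmul,
    AddEquiv.apply_symm_apply] at h
  exact h

/-- **`(irr_K)` from surjectivity over `ℚ` (`p` odd, `[K : ℚ] = 2`).** For `E/ℚ` with `ρ̄_{E,p}` onto and a quadratic
field `K`, `E[p]` is irreducible as a `Γ_K`-module (`(W.baseChange K).HasIrreducibleModPGaloisRep p`) — without the
`(N_E, d_K) = 1` of Matar–Nekovář 2019 Prop. 5.26 (2). [cite: Serre1972, §2 (subgroups of GL₂(𝔽_p))] -/
theorem hasIrreducibleModPGaloisRep_baseChange_of_hasSurjectiveModNGaloisRep (h2 : Module.finrank ℚ K = 2)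
    {p : ℕ} [Fact p.Prime] (hp2 : p ≠ 2) (hsurj : W.HasSurjectiveModNGaloisRep (p : ℤ)) :
    (W.baseChange K).HasIrreducibleModPGaloisRep p := by
  haveI : NeZero ((p : ℕ) : ℚ) := ⟨by exact_mod_cast (Fact.out : p.Prime).ne_zero⟩
  intro H hH
  obtain ⟨ψ, hψ⟩ := exists_addEquiv_geomTorsion_baseChange W K (p : ℤ)
  set Φ : AddSubgroup (geomTorsion W (p : ℤ)) := H.comap ψ.toAddMonoidHom with hΦdef
  have hΦmem : ∀ T, T ∈ Φ ↔ ψ T ∈ H := fun T ↦ Iff.rfl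
  have hΦ : ∀ σ ∈ ((absGaloisRestrict ℚ K).range : Set (absoluteGaloisGroup ℚ)), ∀ P ∈ Φ, σ • P ∈ Φ := by
    rintro σ ⟨γ, rfl⟩ P hP
    rw [hΦmem] at hP ⊢
    change ψ (absGaloisRestrict ℚ K γ • P) ∈ H
    rw [hψ]
    exact hH γ _ hP
  rcases eq_bot_or_eq_top_of_hasSurjectiveModNGaloisRep W p hp2 hsurj _
      (fun σ ↦ sq_mem_range_absGaloisRestrict_of_finrank_eq_two K h2 σ) Φ hΦ with h | h
  · left
    rw [AddSubgroup.eq_bot_iff_forall] at h ⊢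
    intro Q hQ
    have hQ' : ψ.symm Q ∈ Φ := by
      rw [hΦmem, AddEquiv.apply_symm_apply]
      exact hQ
    have h0 := h _ hQ'
    rw [← ψ.apply_symm_apply Q, h0, map_zero]
  · right
    rw [eq_top_iff]
    intro Q _
    have hQ' : ψ.symm Q ∈ Φ := h ▸ AddSubgroup.mem_top _
    rw [hΦmem, AddEquiv.apply_symm_apply] at hQ'
    exact hQ'

/-- **A homothety `−1` in `ρ̄_{E,p}(Γ_K)`** for `E/ℚ` with `ρ̄_{E,p}` onto and `[K : ℚ] = 2`: some `z ∈ Γ_K` acts on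
`E_K(K̄)[p]` as `−1` (`−1 = R²` is a square of `Aut E[p]`, and `res(Γ_K)` contains all squares of `Γ_ℚ`).  This is the
homothety input `hz`/`ha` (`z ≡ a = −1`, `p ∤ a − 1 = −2` for `p` odd) of x9's `eisensteinTower_h2Tower` /
`eisensteinDVRSettingLevelsTame_satisfiesH_of_ofLifts` (Howard's H.2 via Sah's lemma).
[cite: Howard2004HeegnerKolyvagin, §1.3 hypothesis H.2] -/
theorem exists_smul_eq_neg_baseChange_of_hasSurjectiveModNGaloisRep (h2 : Module.finrank ℚ K = 2)
    {p : ℕ} [Fact p.Prime] (hsurj : W.HasSurjectiveModNGaloisRep (p : ℤ)) :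
    ∃ z : absoluteGaloisGroup K, ∀ P : geomTorsion (W.baseChange K) (p : ℤ), z • P = (-1 : ℤ) • P := by
  haveI : NeZero ((p : ℕ) : ℚ) := ⟨by exact_mod_cast (Fact.out : p.Prime).ne_zero⟩
  obtain ⟨ψ, hψ⟩ := exists_addEquiv_geomTorsion_baseChange W K (p : ℤ)
  obtain ⟨σ, hσ⟩ := exists_sq_smul_eq_neg_of_hasSurjectiveModNGaloisRep W p hsurj
  obtain ⟨z, hz⟩ := sq_mem_range_absGaloisRestrict_of_finrank_eq_two K h2 σ
  have hz' : absGaloisRestrict ℚ K z = σ * σ := hz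
  refine ⟨z, fun P ↦ ?_⟩
  have h := hψ z (ψ.symm P)
  rw [AddEquiv.apply_symm_apply, hz', hσ, map_neg, AddEquiv.apply_symm_apply] at h
  rw [← h, neg_one_zsmul]

end Quadratic

/-! ### §3 The twin at `p = 3`: the `hschur` / `hirr` inputs of `eisensteinDVRSettingTame_satisfiesH_of` -/

section Twin

variable (W' : WeierstrassCurve ℚ) [W'.IsElliptic] (K : Type) [Field K] [NumberField K]

/-- **`hschur` for the twin at `3`.** For `E′/ℚ` with `ρ̄_{E′,3}` onto (`W′.HasSurjectiveModNGaloisRep 3`, a hypothesis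
of crux 24737) and `K` imaginary quadratic, every `Γ_K`-equivariant additive endomorphism of `E′_K(K̄)[3]` is an
integer scalar — VERBATIM the binder `hschur` of `WeierstrassCurve.eisensteinDVRSettingTame_satisfiesH_of` at
`W := W′`, `p := 3` (Howard's H.1 for the twin; E2 input of `stub_howardOutputsOfFamily`, line `beta-road`).
[cite: Howard2004HeegnerKolyvagin, §1.3 hypothesis H.1] -/
theorem twin_hschur_at_three (hsurj : W'.HasSurjectiveModNGaloisRep 3) (hK : IsImaginaryQuadratic K) :
    ∀ φ : geomTorsion (W'.baseChange K) ((3 : ℕ) : ℤ) →+ geomTorsion (W'.baseChange K) ((3 : ℕ) : ℤ),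
      (∀ (g : absoluteGaloisGroup K) (P : geomTorsion (W'.baseChange K) ((3 : ℕ) : ℤ)), φ (g • P) = g • φ P) →
        ∃ c : ℤ, ∀ P : geomTorsion (W'.baseChange K) ((3 : ℕ) : ℤ), φ P = c • P := by
  haveI : Fact (Nat.Prime 3) := ⟨Nat.prime_three⟩
  have h3 : W'.HasSurjectiveModNGaloisRep ((3 : ℕ) : ℤ) := by simpa only [Nat.cast_ofNat] using hsurj
  intro φ hφ
  exact exists_forall_eq_zsmul_baseChange_of_hasSurjectiveModNGaloisRep W' K hK.1 (by norm_num) h3 φ hφ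

/-- **`hirr` for the twin at `3`.** For `E′/ℚ` with `ρ̄_{E′,3}` onto and `K` imaginary quadratic, `E′[3]` is irreducible
over `K` — the binder `hirr` of `WeierstrassCurve.eisensteinDVRSettingTame_satisfiesH_of` at `W := W′`, `p := 3`,
with no `(N′, d_K) = 1` hypothesis. [cite: Howard2004HeegnerKolyvagin, §1.3 hypothesis H.1] -/
theorem twin_hirr_at_three (hsurj : W'.HasSurjectiveModNGaloisRep 3) (hK : IsImaginaryQuadratic K) :
    (W'.baseChange K).HasIrreducibleModPGaloisRep 3 := by
  haveI : Fact (Nat.Prime 3) := ⟨Nat.prime_three⟩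
  have h3 : W'.HasSurjectiveModNGaloisRep ((3 : ℕ) : ℤ) := by simpa only [Nat.cast_ofNat] using hsurj
  exact hasIrreducibleModPGaloisRep_baseChange_of_hasSurjectiveModNGaloisRep W' K hK.1 (by norm_num) h3

/-- **Homothety for the twin at `3`.** For `E′/ℚ` with `ρ̄_{E′,3}` onto and `K` imaginary quadratic, some `z ∈ Γ_K` acts on
`E′_K(K̄)[3]` as the scalar `a = −1`, and `3 ∤ a − 1` — the binders `hz` / `ha` of x9's
`WeierstrassCurve.eisensteinDVRSettingLevelsTame_satisfiesH_of_ofLifts` (input of `eisensteinTower_h2Tower`, Howard's H.2)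
at `W := W′`, `p := 3`. [cite: Howard2004HeegnerKolyvagin, §1.3 hypothesis H.2] -/
theorem twin_homothety_at_three (hsurj : W'.HasSurjectiveModNGaloisRep 3) (hK : IsImaginaryQuadratic K) :
    ∃ (z : absoluteGaloisGroup K) (a : ℤ),
      (∀ P : geomTorsion (W'.baseChange K) ((3 : ℕ) : ℤ), z • P = a • P) ∧ ¬ ((3 : ℕ) : ℤ) ∣ a - 1 := by
  haveI : Fact (Nat.Prime 3) := ⟨Nat.prime_three⟩
  have h3 : W'.HasSurjectiveModNGaloisRep ((3 : ℕ) : ℤ) := by simpa only [Nat.cast_ofNat] using hsurj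
  obtain ⟨z, hz⟩ := exists_smul_eq_neg_baseChange_of_hasSurjectiveModNGaloisRep W' K hK.1 h3
  exact ⟨z, -1, hz, by decide⟩

end Twin

end Summit.BirchSwinnertonDyer.BirchSwinnertonDyer.Theorems.UniversalToricDescentTwinSchurAtThree

end
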